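import Summits.ABC.StewartYu.PadicG3TwoValues
import Summits.ABC.StewartYu.SiegelOnFinset
import HarnessLib

/-!
# Cell abc-stewartyu, Gen-3 frame at `p = 2` (crux `Y07Two`, stmt-ABC-19659), layer F3: the SIEGEL STEP —
# integer coefficients `p ≠ 0` of controlled size with `φ_τ(x) = 0` on any finite set of (point, multi-index)
# pairs of at most half the number of unknowns

`Summits/ABC/StewartYu/PadicG3TwoSiegel.lean` — cell `abc-stewartyu` (HOME `run/shared/lean/pub/abc-stewartyu/`),
route `PadicPrimesKummerThird`, seat p3 (g5), F-two LEAD (layer plan HOME/p3/memo-09 §3, F3).  Theorems only,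
on the M2 datum `TwoSetup`.

Level `0` of the frame (Yu 2013 Lemma 4.2; Nesterenko 2003 Prop. 3.9): the auxiliary polynomial is an
INTEGER vector `p` on the unknown family `B` (the Matveev box), not all zero, with
`φ_τ(x) = g3φ τ x = 0` for every `(x, τ)` in a finite set `E` of (integer point, multi-index) pairs with
`2·#E ≤ #B`, and `|pᵢ| ≤ ⌈#B·Amax⌉` where `Amax` bounds the CLEARED coefficients
`D(x,τ)·(Hasse_{t₀} Rᵢ)(x)·∏ zγⱼ^{tⱼ}·zmonᵢ(x)` — by `PadicG3TwoValues.exists_int_clear_mul_coef`,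
`Amax ≥ M₀·Xb^{|t|}·monDen(all, boxExp x)²` suffices.  The lemma is the cell's finset Siegel lemma
`SiegelFinset.exists_int_vec_of_finset` (Dirichlet exponent `#E/(#B − #E) ≤ 1`) applied to the system.

WHAT THIS IS NOT: no choice of the box or of `E` (the record's counts), no extrapolation; no crux moves.

References: K. Yu, Acta Math. 211 (2013), Lemma 4.2, (4.26)–(4.30); Yu. V. Nesterenko, LNM 1819 (2003),
Prop. 3.9; E. Bombieri, J. Vaaler, Invent. Math. 73 (1983) (Siegel's lemma).
-/

noncomputable section

open Finset Polynomial
open Literature.NumberTheory.Transcendental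
open Literature.NumberTheory.Transcendental.CW77.Setup (Tau tauNorm)

namespace Summit.ABC.StewartYu

namespace TwoSetup

variable (S : TwoSetup) {ι : Type*} (R : ι → ℚ[X]) (u : ι → Fin S.d → ℤ) (uθ : ι → ℤ)

/-- **The Siegel step of the Gen-3 `2`-adic frame.**  Unknowns `i ∈ B` (signed exponent box `|uᵢⱼ| ≤ Dⱼ`,
`|u_θᵢ| ≤ D_θ`, directional scalars `|𝔛ⱼ(i)| ≤ Xb`), equations `(x, τ) ∈ E` (nonempty, `2·#E ≤ #B`), `Y₀`-weight
data `den₀(x,τ) ≥ 1`, `den₀·(Hasse_{t₀} Rᵢ)(x) ∈ ℤ` of size `≤ M₀`, and `Amax ≥ M₀·Xb^{|t|}·monDen(x)²` on `E`: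
there is an integer vector `p` supported in `B`, not all zero, `|pᵢ| ≤ ⌈#B·Amax⌉`, with
`g3φ τ x = 0` for all `(x, τ) ∈ E`. [cite: Yu2013, Lemma 4.2] -/
theorem exists_g3_siegel [DecidableEq ι] (B : Finset ι) (E : Finset (ℤ × Tau S.d)) (hE : E.Nonempty)
    (hcard : 2 * E.card ≤ B.card)
    {Dbox : Fin S.d → ℕ} {Dθ : ℕ} (hu : ∀ i ∈ B, ∀ j, |u i j| ≤ (Dbox j : ℤ))
    (huθ : ∀ i ∈ B, |uθ i| ≤ (Dθ : ℤ))
    (den₀ : ℤ × Tau S.d → ℕ) (hden₀ : ∀ e ∈ E, 1 ≤ den₀ e) {M₀ : ℤ}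
    (hR : ∀ e ∈ E, ∀ i ∈ B,
      ∃ z₀ : ℤ, (den₀ e : ℚ) * (hasseDeriv e.2.1 (R i)).eval (e.1 : ℚ) = z₀ ∧ |z₀| ≤ M₀)
    {Xb : ℤ} (hX : ∀ i ∈ B, ∀ j, |S.dirScalar (u i) (uθ i) j| ≤ Xb)
    {Amax : ℝ} (hAmax : 1 ≤ Amax)
    (hA : ∀ e ∈ E, (M₀ : ℝ) * (Xb : ℝ) ^ (∑ j, e.2.2 j) *
      ((MonomialDen.monDen S.toQ.all (S.boxExp Dbox Dθ e.1) : ℝ)) ^ 2 ≤ Amax) :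
    ∃ p : ι → ℤ, (∀ i, p i ≠ 0 → i ∈ B) ∧ (∃ i, p i ≠ 0) ∧
      (∀ i, |p i| ≤ ⌈(B.card : ℝ) * Amax⌉) ∧
      ∀ e ∈ E, S.g3φ R u uθ B p e.2 e.1 = 0 := by
  classical
  -- the system: coefficient of the unknown `i` in the equation `e = (x, τ)`
  set coeff : ℤ × Tau S.d → ι → ℚ := fun e i =>
    (hasseDeriv e.2.1 (R i)).eval (e.1 : ℚ) * S.zγpow u uθ i e.2.2 * S.zmon (u i) (uθ i) e.1 with hcoeff
  -- the clearing denominators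
  set Dc : ℤ × Tau S.d → ℕ := fun e =>
    den₀ e * S.bθ.natAbs ^ (∑ j, e.2.2 j) * MonomialDen.monDen S.toQ.all (S.boxExp Dbox Dθ e.1) with hDc
  have hb1 : 1 ≤ S.bθ.natAbs := Int.natAbs_pos.mpr S.bθ_ne
  have hDpos : ∀ e ∈ E, 0 < Dc e := by
    intro e he
    have hmon1 : 1 ≤ MonomialDen.monDen S.toQ.all (S.boxExp Dbox Dθ e.1) :=
      MonomialDen.one_le_monDen _ S.toQ.all_ne _
    have : 1 ≤ Dc e := one_le_mul (one_le_mul (hden₀ e he) (Nat.one_le_pow _ _ hb1)) hmon1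
    omega
  -- integrality and size of the cleared coefficients
  have hclear : ∀ e ∈ E, ∀ i ∈ B, ∃ z : ℤ, (Dc e : ℚ) * coeff e i = z ∧
      |z| ≤ M₀ * Xb ^ (∑ j, e.2.2 j) * ((MonomialDen.monDen S.toQ.all (S.boxExp Dbox Dθ e.1) : ℤ)) ^ 2 := by
    intro e he i hi
    exact S.exists_int_clear_mul_coef R u uθ i (hu i hi) (huθ i hi) e.2 e.1 (hR e he i hi) (hX i hi)
  have hint : ∀ e ∈ E, ∀ i ∈ B, ∃ z : ℤ, (Dc e : ℚ) * coeff e i = z :=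
    fun e he i hi => by obtain ⟨z, hz, _⟩ := hclear e he i hi; exact ⟨z, hz⟩
  have hAbound : ∀ e ∈ E, ∀ i ∈ B, ((|(Dc e : ℚ) * coeff e i| : ℚ) : ℝ) ≤ Amax := by
    intro e he i hi
    obtain ⟨z, hz, hzle⟩ := hclear e he i hi
    rw [hz]
    push_cast
    have h1 : |(z : ℝ)| ≤ (M₀ : ℝ) * (Xb : ℝ) ^ (∑ j, e.2.2 j) *
        ((MonomialDen.monDen S.toQ.all (S.boxExp Dbox Dθ e.1) : ℝ)) ^ 2 := by
      have := (Int.cast_le (R := ℝ)).mpr hzle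
      push_cast at this
      exact this
    exact h1.trans (hA e he)
  obtain ⟨p, hsupp, hne, hbound, hsol⟩ :=
    SiegelFinset.exists_int_vec_of_finset B E hE hcard coeff Dc hDpos hint hAmax hAbound
  refine ⟨p, hsupp, hne, hbound, fun e he => ?_⟩
  have h := hsol e he
  unfold g3φ
  rw [← h]
  refine Finset.sum_congr rfl fun i _ => ?_
  simp only [hcoeff]
  ring

end TwoSetup

end Summit.ABC.StewartYu

end
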